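import Mathlib
import Literature.Probability.LatticeModels.ProdBernoulliIndependence
import Literature.Probability.Percolation.ConditionalPositiveAssociation
import Literature.Probability.Percolation.ConditionalPositiveAssociationProofs
import Literature.Probability.Percolation.TwoClusterConditionalAssociation
import Literature.Probability.Percolation.PercolationProofs
import HarnessLib

/-! # Crux `PercNearOneGluing.AdditiveGluing` (stmt-CriticalPhenomena-4576), line
`subuniform-dead-pocket-maximum`, stub `stub_goodStep` — helper `goodStep_bhkChain`

Helper file for the crux (siege seat k27 on `stub_goodStep`; lands with
`--supports stmt-CriticalPhenomena-4576`).

## Content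

The **functions version of Kozma–Nitzan's Lemma 3(ii) chain** (arXiv:2401.12397, proof of Lemma 3,
pp. 6–7), which is the engine of the partial result "C1 for down-closed dead families" on the
two-relay kernel of `stub_goodStep` (evidence file `goodstep-bk-k27.md` §4 on the crux item): for the
finite weighted graph (`μ = prodBernoulli w` on `BondConfig V = Set (Sym2 V)`), two relays `a₂ ≠ a₁`,
a target `b`, `D := {a₂ ↮ a₁}`, `C := C_{a₂}` the open edge cluster of `a₂`, and two ANTITONE
functions `F, g` of a set of edges with `0 ≤ g ≤ 1`:
if `μ(D ∩ {a₂ ↔ b}) ≤ ∫_D F(C) dμ + δ` (`δ ≥ 0`), then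
`∫_D 1{a₂ ↔ b} g(C) dμ ≤ ∫_D F(C) g(C) dμ + δ`.
In the application `g(C) = 1{o ∉ V(C)} · μ_{G−V(C)}(C(o) ∉ T)` (antitone for a down-closed family
`T` of dead pockets) and `F(C) = 1{b ∉ V(C)} · μ_{G−V(C)}(a₁ ↔ b)`, and the two sides are
`μ(D ∩ {a₂↔b} ∩ Q_T)` and (a lower bound for) `μ(D ∩ {a₁↔b} ∩ Q_T)`, `Q_T = {o ↮ a₂} ∖ {C(o) ∈ T}`.

Proof (KN pp. 6–7 with `1_Q` replaced by `g`).  With `m = μ(D)`, `q = ∫_D g(C)`,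
`x₂ = μ(D ∩ {a₂↔b})`, `y₂ = ∫_D 1{a₂↔b} g(C)`, `x₁' = ∫_D F(C)`, `z = ∫_D F(C) g(C)`:
* van den Berg–Häggström–Kahn 2006 Thm. 1.3, increasing/decreasing case (`s = a₂`, `X = {a₁}`,
  `f = 1{a₂ ↔ b}` an increasing function of `C_{a₂}`, `g` antitone):  `m y₂ ≤ x₂ q`
  (`BHK2006_clusterConditionalPositiveAssociation_holds` + `.antitone_right`, both in the tree);
* BHK Thm. 1.3 for the two increasing functions `−F, −g`:  `x₁' q ≤ m z`;
* `0 ≤ q ≤ m` since `0 ≤ g ≤ 1`.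
Hence `m y₂ ≤ x₂ q ≤ (x₁' + δ) q ≤ m z + δ m` and `y₂ ≤ z + δ` (if `m = 0` all integrals over `D`
vanish).  No new definitions.
-/

namespace Summit.CriticalPhenomena.PercolationContinuityZ3.Theorems

open scoped BigOperators Classical
open MeasureTheory Set
open Literature.Probability.LatticeModels (prodBernoulli)
open Literature.Probability.Percolation

section BhkChain

universe u

variable {V : Type u} [Fintype V]

/-- Real-arithmetic core of the chain: `m y₂ ≤ x₂ q`, `x₁ q ≤ m z`, `x₂ ≤ x₁ + δ`, `0 ≤ q ≤ m`,
`0 ≤ δ`, and (`m = 0 → y₂ ≤ z`) give `y₂ ≤ z + δ`. [folklore] -/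
theorem goodStep_bhkChain_arith {m q x₁ x₂ y₂ z δ : ℝ}
    (hδ : 0 ≤ δ) (hq0 : 0 ≤ q) (hqm : q ≤ m)
    (hI : m * y₂ ≤ x₂ * q) (hII : x₁ * q ≤ m * z) (hx : x₂ ≤ x₁ + δ)
    (h0 : m = 0 → y₂ ≤ z) :
    y₂ ≤ z + δ := by
  rcases eq_or_lt_of_le (le_trans hq0 hqm) with hm0 | hmpos
  · have := h0 hm0.symm
    linarith
  · refine le_of_mul_le_mul_left ?_ hmpos
    calc m * y₂ ≤ x₂ * q := hI
      _ ≤ (x₁ + δ) * q := mul_le_mul_of_nonneg_right hx hq0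
      _ = x₁ * q + δ * q := add_mul _ _ _
      _ ≤ m * z + δ * m := add_le_add hII (mul_le_mul_of_nonneg_left hqm hδ)
      _ = m * (z + δ) := by ring

/-- **Functions version of the Kozma–Nitzan Lemma 3(ii) chain** (arXiv:2401.12397, proof of
Lemma 3, pp. 6–7; van den Berg–Häggström–Kahn 2006 Thm. 1.3 applied twice).  `μ = prodBernoulli w`,
`D = {a₂ ↮ a₁}`, `C = C_{a₂}` the open edge cluster of `a₂`; `F, g` antitone functions of a set of
edges, `0 ≤ g ≤ 1`.  If `μ(D ∩ {a₂ ↔ b}) ≤ ∫_D F(C) dμ + δ` with `δ ≥ 0`, then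
`∫_D 1{a₂ ↔ b}·g(C) dμ ≤ ∫_D F(C)·g(C) dμ + δ`.
[cite: KozmaNitzan2024, Lemma 3(ii) (proof); VandenbergHaggstromKahn2005, Thm. 1.3] -/
theorem goodStep_bhkChain (w : Sym2 V → unitInterval) (a₁ a₂ b : V)
    (F g : Set (Sym2 V) → ℝ) (δ : ℝ)
    (hF : Antitone F) (hg : Antitone g) (hg0 : ∀ C, 0 ≤ g C) (hg1 : ∀ C, g C ≤ 1)
    (hδ : 0 ≤ δ) (h21 : a₂ ≠ a₁)
    (hx : (prodBernoulli w).real ((openConn a₂ a₁)ᶜ ∩ openConn a₂ b) ≤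
      (∫ ω in (openConn a₂ a₁ : Set (BondConfig V))ᶜ, F (openEdgeCluster ω a₂) ∂(prodBernoulli w))
        + δ) :
    (∫ ω in (openConn a₂ a₁ : Set (BondConfig V))ᶜ,
        (openConn a₂ b : Set (BondConfig V)).indicator (1 : BondConfig V → ℝ) ω *
          g (openEdgeCluster ω a₂) ∂(prodBernoulli w)) ≤
      (∫ ω in (openConn a₂ a₁ : Set (BondConfig V))ᶜ,
        F (openEdgeCluster ω a₂) * g (openEdgeCluster ω a₂) ∂(prodBernoulli w)) + δ := by
  set μ := prodBernoulli w with hμ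
  set D : Set (BondConfig V) := (openConn a₂ a₁ : Set (BondConfig V))ᶜ with hDdef
  have hD : {ω : BondConfig V | ∀ y ∈ ({a₁} : Set V), ¬ (openGraph ω).Reachable a₂ y} = D := by
    ext ω
    simp only [Set.mem_setOf_eq, Set.mem_singleton_iff, forall_eq, hDdef, Set.mem_compl_iff]
    rfl
  have hnot : a₂ ∉ ({a₁} : Set V) := fun h => h21 (Set.mem_singleton_iff.1 h)
  have hma : MeasurableSet (openConn a₂ b : Set (BondConfig V)) := measurableSet_openConn_holds a₂ b
  have hmD : MeasurableSet D := MeasurableSet.of_discrete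
  -- (I) BHK Thm 1.3, increasing/decreasing: `m * y₂ ≤ x₂ * q`
  have keyI := BHK2006_clusterConditionalPositiveAssociation.antitone_right
    BHK2006_clusterConditionalPositiveAssociation_holds V w a₂ ({a₁} : Set V)
    (connIndicatorFn a₂ b) g (monotone_connIndicatorFn a₂ b) hg hnot
  simp only [connIndicatorFn_openEdgeCluster, hD] at keyI
  rw [setIntegral_indicator hma] at keyI
  simp only [Pi.one_apply, setIntegral_const, smul_eq_mul, mul_one] at keyI
  -- (II) BHK Thm 1.3 for the increasing functions `-F`, `-g`: `x₁ * q ≤ m * z`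
  have hnF : Monotone (fun C => -F C) := fun _ _ hab => neg_le_neg (hF hab)
  have hng : Monotone (fun C => -g C) := fun _ _ hab => neg_le_neg (hg hab)
  have keyII := BHK2006_clusterConditionalPositiveAssociation_holds V w a₂ ({a₁} : Set V)
    (fun C => -F C) (fun C => -g C) hnF hng hnot
  simp only [hD, integral_neg, mul_neg, neg_mul, neg_neg] at keyII
  -- `0 ≤ q ≤ m`
  have hq0 : 0 ≤ ∫ ω in D, g (openEdgeCluster ω a₂) ∂μ :=
    setIntegral_nonneg hmD fun ω _ => hg0 _
  have hqm : (∫ ω in D, g (openEdgeCluster ω a₂) ∂μ) ≤ μ.real D := by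
    have h1 : (∫ ω in D, g (openEdgeCluster ω a₂) ∂μ) ≤ ∫ ω in D, (1 : ℝ) ∂μ := by
      refine setIntegral_mono_on (Integrable.of_finite) (Integrable.of_finite) hmD ?_
      intro ω _
      exact hg1 _
    simpa only [setIntegral_const, smul_eq_mul, mul_one] using h1
  -- the indicator integral is `x₂`-like: rewrite `∫_D 1{a₂↔b} g` stays as is; assemble
  refine goodStep_bhkChain_arith (m := μ.real D)
    (q := ∫ ω in D, g (openEdgeCluster ω a₂) ∂μ)
    (x₁ := ∫ ω in D, F (openEdgeCluster ω a₂) ∂μ)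
    (x₂ := μ.real (D ∩ openConn a₂ b))
    (y₂ := ∫ ω in D, (openConn a₂ b : Set (BondConfig V)).indicator (1 : BondConfig V → ℝ) ω *
      g (openEdgeCluster ω a₂) ∂μ)
    (z := ∫ ω in D, F (openEdgeCluster ω a₂) * g (openEdgeCluster ω a₂) ∂μ)
    hδ hq0 hqm ?_ ?_ hx ?_
  · -- (I): the integrand `1{a₂↔b} ω * g(C ω)` equals the one in `keyI`
    have : (∫ ω in D, (openConn a₂ b : Set (BondConfig V)).indicator (1 : BondConfig V → ℝ) ω *
        g (openEdgeCluster ω a₂) ∂μ) =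
        ∫ ω in D, (openConn a₂ b : Set (BondConfig V)).indicator 1 ω * g (openEdgeCluster ω a₂) ∂μ :=
      rfl
    linarith [keyI]
  · linarith [keyII]
  · -- `m = 0`: all integrals over `D` vanish
    intro hm0
    have hD0 : μ D = 0 := (measureReal_eq_zero_iff (measure_ne_top μ D)).1 hm0
    have hres : μ.restrict D = 0 := Measure.restrict_eq_zero.2 hD0
    simp only [hres, integral_zero_measure, le_refl]

/-- **Registered sub-goal `stub_goodStepBhkChain_k27` of the crux item** (siege seat k27 on
`stub_goodStep`): the functions version of the Kozma–Nitzan Lemma 3(ii) chain on `Fin n`, i.e.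
`goodStep_bhkChain` specialised to the line's vertex type.
[cite: KozmaNitzan2024, Lemma 3(ii) (proof); VandenbergHaggstromKahn2005, Thm. 1.3] -/
theorem stub_goodStepBhkChain_k27 : ∀ (n : ℕ) (w : Sym2 (Fin n) → unitInterval) (a₁ a₂ b : Fin n) (F g : Set (Sym2 (Fin n)) → ℝ) (δ : ℝ), Antitone F → Antitone g → (∀ C, 0 ≤ g C) → (∀ C, g C ≤ 1) → 0 ≤ δ → a₂ ≠ a₁ → (prodBernoulli w).real ((openConn a₂ a₁)ᶜ ∩ openConn a₂ b) ≤ (∫ ω in (openConn a₂ a₁ : Set (BondConfig (Fin n)))ᶜ, F (openEdgeCluster ω a₂) ∂(prodBernoulli w)) + δ → (∫ ω in (openConn a₂ a₁ : Set (BondConfig (Fin n)))ᶜ, (openConn a₂ b : Set (BondConfig (Fin n))).indicator (1 : BondConfig (Fin n) → ℝ) ω * g (openEdgeCluster ω a₂) ∂(prodBernoulli w)) ≤ (∫ ω in (openConn a₂ a₁ : Set (BondConfig (Fin n)))ᶜ, F (openEdgeCluster ω a₂) * g (openEdgeCluster ω a₂) ∂(prodBernoulli w)) + δ :=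
  fun n w a₁ a₂ b F g δ hF hg hg0 hg1 hδ h21 hx =>
    goodStep_bhkChain (V := Fin n) w a₁ a₂ b F g δ hF hg hg0 hg1 hδ h21 hx

end BhkChain

end Summit.CriticalPhenomena.PercolationContinuityZ3.Theorems
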